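import Summits.HodgeConjecture.HodgeConjecture.Theorems.Ring2AbelianAllLandherr
import Summits.HodgeConjecture.HodgeConjecture.Theorems.Ring2HabitatWeilComponentsRefereedFourfolds
import HarnessLib

/-!
# Ring 2 · Habitat (seat `habitat1`, gen 20) — the Schoen-1988 split fourfold row RE-BASED: no Landherr binder

HONEST FRAMING (cell `pub-hodge-ring2`, verbatim): research route conditional on HC_CM; not a corollary;
Q11.4-sentence-2 already refuted in dim ≥ 3. `HC_CM` (`Theses.RankFourFaces.CMAbelianHodge`) does not occur in this
file; no open case of the Hodge conjecture is claimed; no definition, no named fact, no `sorry`. The refereed named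
fact (Schoen 1988 / van Geemen Thm. 4.15) stays an explicit HYPOTHESIS.

This is the one-term re-base asked for by the LEAD (L18.3 (iv), "`RefereedFourfolds` l.229 one row"): the row
`Ring2.Habitat.weilClassesComponent_split_two_of_schoen1988` (`Ring2HabitatWeilComponentsRefereedFourfolds` §4)
carried the typed print obligation `(hL : Ring2.Hypotheses.LandherrSplitCriterion)` (van Geemen LNM 1594 (5.4.1) after
Landherr 1936). That obligation is now a THEOREM of the tree, `Ring2.AbelianAll.landherrSplitCriterion_holds`
(seat `ab-weil-2`, `Ring2AbelianAllLandherr`: Landherr via Meyer on the carriers, all proved in `Literature/`), so the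
row is re-stated WITHOUT it. It lives in a separate file because `Ring2AbelianAllLandherr` imports
`Ring2HabitatWeilComponentsRefereedFourfolds` transitively (via `Ring2AbelianAllWeilFloor`); the original row is kept.

## What is proved (0 sorry; a one-line instantiation)

* `weilClassesComponent_split_two_of_schoen1988'` — the split fourfold cell `(2, d, +1)`, `d ∈ {1, 3}`
  (`WeilClassesComponent 2 d (splitDiscriminantClass 2 d)`) from the ONE refereed named fact
  `Schoen1988_weilClasses_algebraic_hyperbolicFourfold_three_or_one`, no Landherr binder — a second refereed
  closing of the split fourfold cells of `ℚ(i)`, `ℚ(√-3)` next to `Ring2.AbelianAll.weilClassesComponent_split_two_of_markman2023'`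
  (Markman 2023, every `d`).

## References

* [Schoen1988HodgeWeil] C. Schoen, Hodge classes on self-products of a variety with an automorphism,
  Compositio Math. 65 (1988) 3–32, Thm. 3.2 and §3.
* [vanGeemen1994HodgeAV] B. van Geemen, An introduction to the Hodge conjecture for abelian varieties, LNM 1594 (1994),
  Thm. 4.15, 5.4 and (5.4.1).
* [Landherr1936HermitianForms] W. Landherr, Abh. Math. Sem. Hamburg 11 (1936) 245–248.
-/

set_option linter.dupNamespace false

noncomputable section

open CategoryTheory
open Literature.AlgebraicGeometry Literature.AlgebraicGeometry.Motives
open Literature.AlgebraicGeometry.HodgeTheory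
open Literature.AlgebraicGeometry.VanGeemen1994
open Literature.AlgebraicTopology.SingularHomology
open Summit.HodgeConjecture.HodgeConjecture.Ring2.Hypotheses

namespace Summit.HodgeConjecture.HodgeConjecture.Ring2.Habitat

/-! ### §4′ The split fourfold cell `(2, d, +1)`, `d ∈ {1, 3}`, from the 1988 source — binder-free -/

/-- **Cell `(2, d, +1)` for `d ∈ {1, 3}` from Schoen 1988 / van Geemen Thm. 4.15
(`Schoen1988_weilClasses_algebraic_hyperbolicFourfold_three_or_one`, refereed), NO Landherr binder** — the row
`weilClassesComponent_split_two_of_schoen1988` with `(hL : LandherrSplitCriterion)` discharged by the tree theorem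
`Ring2.AbelianAll.landherrSplitCriterion_holds` (Landherr via Meyer, proved in `Literature/`).
[cite: Schoen1988HodgeWeil, Thm. 3.2 and §3] [cite: vanGeemen1994HodgeAV, Thm. 4.15 and (5.4.1)]
[cite: Landherr1936HermitianForms] -/
theorem weilClassesComponent_split_two_of_schoen1988'
    (hF : Schoen1988_weilClasses_algebraic_hyperbolicFourfold_three_or_one) {d : ℕ} (hd : d = 1 ∨ d = 3) :
    WeilClassesComponent 2 d (splitDiscriminantClass 2 d) :=
  weilClassesComponent_split_two_of_schoen1988 Ring2.AbelianAll.landherrSplitCriterion_holds hF hd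

end Summit.HodgeConjecture.HodgeConjecture.Ring2.Habitat

end
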